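import Literature.NumberTheory.ModularSymbols.CuspidalHomologyDeligneSerreLift
import Literature.NumberTheory.EllipticCurves.NewformsTwistPacketProofs
import Literature.NumberTheory.EllipticCurves.NewformsHeckeStableProofs
import HarnessLib

/-!
# From a characteristic-`0` Hecke eigen-element of `H₁(X₀(L), ℤ)` to a newform packet
# (Eichler–Shimura by duality against the Atkin–Lehner basis)

Topic `Literature/NumberTheory/ModularSymbols`, namespace `Literature.NumberTheory.ModularSymbols`. Theorems only
(no definition, no named fact, no instance / notation). Sequel to `CuspidalHomologyDeligneSerreLift`: there a mod-`ℓ`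
Hecke eigen-system occurring in `Λ = H₁(X₀(L), ℤ) ⊆ S₂(Γ₀(L))^∨` was lifted (Deligne–Serre 6.11) to a NONZERO
`m ∈ Λ` whose annihilator in `ℋ = ℤ[T_p : p ∈ S] ⊆ 𝕋_ℤ` is a minimal prime `P`. Here:

* § 1 (linear algebra) a pairwise commuting FINITE family of endomorphisms of a vector space over an algebraically
  closed field has a joint eigenvector in every nonzero finite-dimensional stable subspace
  (`exists_joint_eigenvector_of_commute`; Hoffman–Kunze § 6.5, Thm. 7 and its Corollary — simultaneous
  triangulation; here from Mathlib's simultaneous generalised eigenspaces plus the tree's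
  `CommutingFamily.exists_joint_eigenvector_of_forall_exists_pow`).
* § 2 **Eigen-functionals have newform packets** (`exists_isNewform0_of_dual_eigenvector`): if a nonzero
  `φ ∈ S_k(Γ₀(L))^∨` satisfies `φ ∘ T_p = c_p φ` for the primes `p` of a set `S`, `p ∤ L`, then there are `M ∣ L`
  and a newform `g₀ ∈ S_k(Γ₀(M))` with `a_p(g₀) = c_p` for all those `p`. Proof: the Atkin–Lehner forms
  `[α_d]_k g₀` (`g₀` a newform of level `M`, `M d ∣ L`) span `S_k(Γ₀(L))` (the tree's
  `iSup_atkinLehnerComponent_eq_top` with `span_newforms0_holds`; Atkin–Lehner 1970 Thm. 5, Diamond–Shurman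
  Thm. 5.8.3) and are `T_p`-eigenvectors with eigenvalue `a_p(g₀)` (`heckeT_degeneracyMap0_of_isNewform0`); `φ ≠ 0`
  does not kill all of them, and `φ([α_d] g₀) ≠ 0` forces `c_p = a_p(g₀)`.
* § 3 **From the lattice eigen-element to an eigen-functional** (`exists_ringHom_dual_eigenvector_of_annihilator`):
  for `ℋ ≤ 𝕋_ℤ` a subring, `P` an ideal of `ℋ` and `m ∈ Λ`, `m ≠ 0`, with `h • m = 0 ↔ h ∈ P`: there are a ring
  homomorphism `σ : ℋ ⧸ P →+* ℂ` and a nonzero `φ ∈ S₂(Γ₀(L))^∨` with `h • φ = σ(h mod P) φ` for every `h ∈ ℋ`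
  (§ 1 applied to the `ℂ`-span of `ℋ • m`, on which `P` acts by `0`); when `P` is prime and `ℋ ⧸ P` is integral
  over `ℤ ↪ ℋ/P`, `σ` is injective (incomparability).
* § 4 **Assembly** (`exists_isNewform0_of_eigenvector_mod`): a mod-`ℓ` eigen-system `(a_p)_{p ∈ S}` occurring in
  `Λ = H₁(X₀(L), ℤ)` (an honest eigenvector `w ∈ Λ ∖ ℓΛ`) is the reduction of the packet of a newform `g₀` of some
  level `M ∣ L`: `a_p(g₀) = σ(T_p mod P)` and `ψ(T_p mod P) = a_p mod ℓ` for all primes `p ∈ S`, `p ≠ ℓ`, `p ∤ L`,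
  with `σ : ℋ/P ↪ ℂ`, `ψ : ℋ/P → ℤ/ℓ` ring homomorphisms out of the order `ℋ/P`.

* § 6 (`exists_maximal_ideal_over_ker`) lying over, as the Galois step consumes it: for an order `R` (module-finite
  over `ℤ`), `σ : R ↪ K ⊆ ℂ` and `ψ : R → ℤ/ℓ`, a maximal ideal `𝔐 ∋ ℓ` of `𝒪_K = integralClosure ℤ K` with
  `σ(r) ≡ z (mod 𝔐)` whenever `ψ(r) = z mod ℓ` (so `a_p(g₀) ≡ a_p (mod 𝔐)` in `𝒪_{K_{g₀}}`).
* § 5 the same in the shape of the TQMP items at `ℓ = 3`: from a joint GENERALISED mod-3 eigenvector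
  (`exists_isNewform0_of_genEigenvector_mod_three`) and from a failure of the norm-image statement at level `N`,
  `9 ∣ N`, giving a newform of level dividing `N/3` (`exists_isNewform0_level_div_three_of_normInt`).

This is the standard passage «eigenclass in `H₁(X₀(L), 𝔽_ℓ)` ⇒ newform `g` with `a_p(g) ≡ a_p (mod λ)`»
(Ash–Stevens 1986 §1; Deligne–Serre 1974 6.11 + Eichler–Shimura), assembled from the tree's theorems. Honest framing:
nothing here concerns Galois representations, Serre weights, or BSD.

## References

* K. Hoffman, R. Kunze, *Linear Algebra*, 2nd ed. (1971), § 6.5, Lemma and Theorem 7 with Corollary (p. 207).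
  [HoffmanKunze1971LinearAlgebra]
* A. O. L. Atkin, J. Lehner, *Hecke operators on Γ₀(m)*, Math. Ann. 185 (1970), Thms. 3, 5. [AtkinLehner1970]
* F. Diamond, J. Shurman, *A First Course in Modular Forms*, GTM 228 (2005), Thm. 5.8.3. [DiamondShurman2005]
* P. Deligne, J-P. Serre, *Formes modulaires de poids 1*, Ann. Sci. ÉNS 7 (1974), Lemme 6.11. [DeligneSerre1974]
-/

namespace Literature.NumberTheory.ModularSymbols

open Literature.NumberTheory.EllipticCurves.ModularForms
open CongruenceSubgroup

/-! ## § 1 Joint eigenvectors of a commuting finite family (algebraically closed field) -/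

section JointEigenvector

/-- **A commuting finite family has a joint eigenvector in every nonzero finite-dimensional stable subspace**
(over an algebraically closed field): for pairwise commuting `f_i` (`i ∈ s`) and a finite-dimensional submodule
`W ≠ 0` stable under every `f_i` there is `v ∈ W`, `v ≠ 0`, with `f_i v = c_i v` for all `i ∈ s`. Proof: on `W`
the simultaneous generalised eigenspaces of the restricted family exhaust `W` (Mathlib
`iSup_iInf_maxGenEigenspace_eq_top_of_iSup_maxGenEigenspace_eq_top_of_commute`), so one of them is nonzero, and a
nonzero joint generalised eigenvector yields a joint eigenvector
(`CommutingFamily.exists_joint_eigenvector_of_forall_exists_pow`). [cite: HoffmanKunze1971LinearAlgebra, §6.5 Thm. 7 and Corollary (p. 207)] -/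
theorem exists_joint_eigenvector_of_commute {K V : Type*} [Field K] [IsAlgClosed K] [AddCommGroup V]
    [Module K V] {ι : Type*} (s : Finset ι) (f : ι → Module.End K V)
    (hc : ∀ i ∈ s, ∀ j ∈ s, Commute (f i) (f j)) (W : Submodule K V) [FiniteDimensional K W]
    (hW : ∀ i ∈ s, W ≤ W.comap (f i)) (hW0 : W ≠ ⊥) :
    ∃ v ∈ W, v ≠ 0 ∧ ∀ i ∈ s, ∃ c : K, f i v = c • v := by
  classical
  -- the restricted family on `W` (zero off `s`)
  have hmaps : ∀ i (_ : i ∈ s), ∀ x ∈ W, f i x ∈ W := fun i hi x hx ↦ hW i hi hx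
  let g : ι → Module.End K W := fun i ↦ if hi : i ∈ s then (f i).restrict (hmaps i hi) else 0
  have hg : ∀ i (hi : i ∈ s), g i = (f i).restrict (hmaps i hi) := fun i hi ↦ dif_pos hi
  have hg0 : ∀ i, i ∉ s → g i = 0 := fun i hi ↦ dif_neg hi
  have hgapply : ∀ i (hi : i ∈ s) (x : W), ((g i x : W) : V) = f i x := fun i hi x ↦ by
    rw [hg i hi]
    rfl
  have hcg : Pairwise fun i j ↦ Commute (g i) (g j) := by
    intro i j _
    by_cases hi : i ∈ s
    · by_cases hj : j ∈ s
      · refine LinearMap.ext fun x ↦ Subtype.ext ?_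
        change ((g i (g j x) : W) : V) = ((g j (g i x) : W) : V)
        rw [hgapply i hi, hgapply j hj, hgapply j hj, hgapply i hi, ← Module.End.mul_apply,
          (hc i hi j hj).eq, Module.End.mul_apply]
      · rw [hg0 j hj]
        exact Commute.zero_right _
    · rw [hg0 i hi]
      exact Commute.zero_left _
  have htop : ⨆ χ : ι → K, ⨅ i, (g i).maxGenEigenspace (χ i) = ⊤ :=
    Module.End.iSup_iInf_maxGenEigenspace_eq_top_of_iSup_maxGenEigenspace_eq_top_of_commute g hcg
      fun i ↦ Module.End.iSup_maxGenEigenspace_eq_top (g i)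
  -- one simultaneous generalised eigenspace is nonzero
  have hW0' : (⊤ : Submodule K W) ≠ ⊥ := by
    intro h
    apply hW0
    rw [eq_bot_iff]
    intro x hx
    have hx' : (⟨x, hx⟩ : W) ∈ (⊤ : Submodule K W) := Submodule.mem_top
    rw [h, Submodule.mem_bot] at hx'
    rw [Submodule.mem_bot]
    exact congrArg Subtype.val hx'
  obtain ⟨χ, hχ⟩ : ∃ χ : ι → K, (⨅ i, (g i).maxGenEigenspace (χ i)) ≠ ⊥ := by
    by_contra h
    push Not at h
    apply hW0'
    rw [← htop, eq_bot_iff]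
    exact iSup_le fun χ ↦ (h χ).le
  obtain ⟨x, hx, hx0⟩ := Submodule.exists_mem_ne_zero_of_ne_bot hχ
  rw [Submodule.mem_iInf] at hx
  have hgen : ∀ i ∈ s, ∃ k : ℕ, ((g i - χ i • (1 : Module.End K W)) ^ k) x = 0 := fun i _ ↦
    (Module.End.mem_maxGenEigenspace _ _ _).mp (hx i)
  obtain ⟨w, -, hw0, hw⟩ :=
    Literature.LinearAlgebra.CommutingFamily.exists_joint_eigenvector_of_forall_exists_pow s g χ
      (fun i _ j _ ↦ by
        rcases eq_or_ne i j with rfl | h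
        exacts [Commute.refl _, hcg h])
      ⊤ (fun _ _ ↦ le_top) (Submodule.mem_top : x ∈ ⊤) hx0 hgen
  refine ⟨(w : V), w.2, fun h ↦ hw0 (Subtype.ext h), fun i hi ↦ ⟨χ i, ?_⟩⟩
  rw [← hgapply i hi, hw i hi, Submodule.coe_smul]

end JointEigenvector

/-! ## § 2 Eigen-functionals on `S_k(Γ₀(L))` have newform packets -/

section Packet

variable (L : ℕ) [NeZero L] (k : ℤ)

/-- **A joint eigen-functional of the `T_p` (`p ∈ S`, `p ∤ L`) on `S_k(Γ₀(L))` has the packet of a newform of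
level dividing `L`.** If `φ ∈ S_k(Γ₀(L))^∨`, `φ ≠ 0`, and `φ(T_p f) = c_p φ(f)` for all `f` and all primes `p ∈ S`,
`p ∤ L`, then there are `M ∣ L` and a newform `g₀ ∈ S_k(Γ₀(M))` (`IsNewform0`) with `a_p(g₀) = c_p` for all those
`p`. Proof: the Atkin–Lehner forms `[α_d]_k g₀` (`g₀ ∈ newforms0 M k`, `M d ∣ L`) span `S_k(Γ₀(L))`
(`iSup_atkinLehnerComponent_eq_top`, `span_newforms0_holds`: Atkin–Lehner Thm. 5) and
`T_p [α_d]_k g₀ = a_p(g₀) [α_d]_k g₀` (`heckeT_degeneracyMap0_of_isNewform0`: Atkin–Lehner Thm. 3); a nonzero `φ`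
has `φ([α_d]_k g₀) ≠ 0` for one of them, and then `c_p φ(v) = φ(T_p v) = a_p(g₀) φ(v)`.
[cite: AtkinLehner1970, Thm. 5 with Thm. 3] [cite: DiamondShurman2005, Thm. 5.8.3] -/
theorem exists_isNewform0_of_dual_eigenvector (φ : Module.Dual ℂ (CuspForm (Gamma0 L) k)) (hφ : φ ≠ 0)
    (S : Set ℕ) (c : ℕ → ℂ)
    (heig : ∀ p ∈ S, ∀ (hp : p.Prime), ¬ p ∣ L → ∀ f : CuspForm (Gamma0 L) k,
      φ ((haveI : NeZero p := ⟨hp.ne_zero⟩; heckeT (Gamma0 L) k p) f) = c p * φ f) :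
    ∃ (M : ℕ) (_ : NeZero M) (_ : M ∣ L) (g₀ : CuspForm (Gamma0 M) k), IsNewform0 g₀ ∧
      ∀ p ∈ S, p.Prime → ¬ p ∣ L → cuspCoeff g₀ p = c p := by
  classical
  by_contra hne
  push Not at hne
  apply hφ
  -- `φ` kills every Atkin–Lehner form, hence everything
  have key : ∀ x : AtkinLehnerIndex L, atkinLehnerComponent L k x ≤ LinearMap.ker φ := by
    intro x
    rw [atkinLehnerComponent, Submodule.map_le_iff_le_comap, ← span_newforms0_holds x.1.1 k,
      Submodule.span_le]
    intro g₀ hg₀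
    have hg₀' : IsNewform0 g₀ := hg₀
    rw [SetLike.mem_coe, Submodule.mem_comap, LinearMap.mem_ker]
    by_contra hv
    obtain ⟨p, hpS, hp, hpL, hne'⟩ := hne x.1.1 inferInstance (dvd_of_mul_right_dvd x.2) g₀ hg₀'
    apply hne'
    have h1 := heig p hpS hp hpL (degeneracyMap0 x.1.1 L x.1.2 k g₀)
    rw [heckeT_degeneracyMap0_of_isNewform0 x.2 hg₀' hp hpL, map_smul, smul_eq_mul] at h1
    exact mul_right_cancel₀ hv h1
  have hker : LinearMap.ker φ = ⊤ := by
    rw [eq_top_iff, ← iSup_atkinLehnerComponent_eq_top k L]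
    exact iSup_le key
  exact LinearMap.ker_eq_top.mp hker

end Packet

/-! ## § 3 From a lattice eigen-element to an eigen-functional with a ring homomorphism of eigenvalues -/

section EigenElement

/-- **Incomparability**: a ring homomorphism from a domain `A` integral over `ℤ` to a domain of characteristic
`0` is injective (its kernel is a prime lying over `(0) ⊂ ℤ`, hence is `(0)`; Atiyah–Macdonald Cor. 5.9).
[cite: AtiyahMacdonald1969, Cor. 5.9] -/
theorem injective_ringHom_of_isIntegral_int {A B : Type*} [CommRing A] [IsDomain A] [Algebra.IsIntegral ℤ A]
    [CommRing B] [IsDomain B] [CharZero B] (σ : A →+* B) : Function.Injective σ := by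
  rw [RingHom.injective_iff_ker_eq_bot]
  haveI : (RingHom.ker σ).IsPrime := RingHom.ker_isPrime σ
  refine Ideal.eq_bot_of_comap_eq_bot (R := ℤ) ?_
  rw [eq_bot_iff]
  intro n hn
  rw [Ideal.mem_comap, RingHom.mem_ker, eq_intCast, map_intCast, Int.cast_eq_zero] at hn
  rw [Ideal.mem_bot]
  exact hn

variable (L : ℕ) [NeZero L]

/-- **From an eigen-element of `Λ = H₁(X₀(L), ℤ)` to a complex eigen-functional.** Let `ℋ ≤ 𝕋_ℤ` be a subring,
`P` an ideal of `ℋ`, and `m ∈ Λ`, `m ≠ 0`, with `h • m = 0 ↔ h ∈ P` (e.g. the output of the Deligne–Serre lift,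
`CuspidalHomologyDeligneSerreLift`). Then there are a ring homomorphism `σ : ℋ ⧸ P →+* ℂ` and a NONZERO
`φ ∈ S₂(Γ₀(L))^∨` with `h • φ = σ(h mod P) • φ` for every `h ∈ ℋ`. Proof: the `ℂ`-span `W` of `ℋ • m` inside
`S₂(Γ₀(L))^∨` is finite-dimensional, nonzero and stable under the commuting operators `h^∨` (`h ∈ ℋ`, a finitely
generated `ℤ`-module), so it contains a joint eigenvector `φ` (§ 1, Hoffman–Kunze § 6.5 Thm. 7); the eigenvalue
map `ℋ → ℂ` is a ring homomorphism (as `φ ≠ 0`) vanishing on `P` (`P` kills `ℋ • m`, hence `W`).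
[cite: HoffmanKunze1971LinearAlgebra, §6.5 Thm. 7 and Corollary (p. 207)] [cite: DeligneSerre1974, Lemme 6.11 (derived reading: «f'' de K ⊗ M … tel que h f'' = χ'(h) f''», realised in S₂(Γ₀(L))^∨ ⊇ Λ)] -/
theorem exists_ringHom_dual_eigenvector_of_annihilator (H : Subalgebra ℤ (HeckeRing0 L 2)) (P : Ideal H)
    (m : periodHomologyHecke L) (hm0 : m ≠ 0) (hm : ∀ h : H, h • m = 0 ↔ h ∈ P) :
    ∃ (σ : H ⧸ P →+* ℂ) (φ : Module.Dual ℂ (CuspForm (Gamma0 L) 2)), φ ≠ 0 ∧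
      ∀ h : H, (h : HeckeRing0 L 2) • φ = σ (Ideal.Quotient.mk P h) • φ := by
  classical
  haveI : FiniteDimensional ℂ (CuspForm (Gamma0 L) 2) := finiteDimensional_cuspForm_gamma0 L 2
  -- the operators `h^∨` as `ℂ`-linear maps, the vectors `h • m`, their span `W`
  let F : H → Module.End ℂ (Module.Dual ℂ (CuspForm (Gamma0 L) 2)) := fun h ↦
    HeckeRing0.dualAction L 2 (h : HeckeRing0 L 2)
  have hF : ∀ (h : H) (φ : Module.Dual ℂ (CuspForm (Gamma0 L) 2)), F h φ = (h : HeckeRing0 L 2) • φ :=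
    fun _ _ ↦ rfl
  let v₀ : H → Module.Dual ℂ (CuspForm (Gamma0 L) 2) := fun h ↦
    (((h : HeckeRing0 L 2) • m : periodHomologyHecke L) : Module.Dual ℂ (CuspForm (Gamma0 L) 2))
  have hv₀ : ∀ h : H, v₀ h = (h : HeckeRing0 L 2) • (m : Module.Dual ℂ (CuspForm (Gamma0 L) 2)) :=
    fun _ ↦ rfl
  let W : Submodule ℂ (Module.Dual ℂ (CuspForm (Gamma0 L) 2)) := Submodule.span ℂ (Set.range v₀)
  have hFv₀ : ∀ h h' : H, F h (v₀ h') = v₀ (h * h') := fun h h' ↦ by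
    rw [hF, hv₀, hv₀, Subalgebra.coe_mul, mul_smul]
  have hW : ∀ h : H, W ≤ W.comap (F h) := fun h ↦ by
    rw [← Submodule.map_le_iff_le_comap, Submodule.map_span, Submodule.span_le]
    rintro _ ⟨_, ⟨h', rfl⟩, rfl⟩
    rw [hFv₀]
    exact Submodule.subset_span ⟨h * h', rfl⟩
  have hW0 : W ≠ ⊥ := by
    intro hbot
    apply hm0
    have h1 : v₀ 1 ∈ W := Submodule.subset_span ⟨1, rfl⟩
    rw [hbot, Submodule.mem_bot, hv₀, Subalgebra.coe_one, one_smul] at h1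
    exact_mod_cast h1
  -- `P` kills `W`
  have hPW : ∀ h : H, h ∈ P → ∀ x ∈ W, F h x = 0 := by
    intro h hP x hx
    induction hx using Submodule.span_induction with
    | mem x hx' =>
      obtain ⟨h', rfl⟩ := hx'
      have h0 : ((h : HeckeRing0 L 2) • m : periodHomologyHecke L) = 0 := (hm h).mpr hP
      rw [hFv₀, mul_comm]
      change (((((h' * h : H) : HeckeRing0 L 2)) • m : periodHomologyHecke L) :
        Module.Dual ℂ (CuspForm (Gamma0 L) 2)) = 0
      rw [Subalgebra.coe_mul, mul_smul, h0, smul_zero, Submodule.coe_zero]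
    | zero => exact map_zero _
    | add x y _ _ hx hy => rw [map_add, hx, hy, add_zero]
    | smul c x _ hx => rw [map_smul, hx, smul_zero]
  -- `ℋ` is a finitely generated `ℤ`-module; a joint eigenvector for a finite generating set
  haveI : Module.Finite ℤ H := Module.Finite.of_injective H.val.toLinearMap Subtype.val_injective
  obtain ⟨t, ht⟩ := Module.Finite.fg_top (R := ℤ) (M := H)
  have hc : ∀ i ∈ t, ∀ j ∈ t, Commute (F i) (F j) := fun i _ j _ ↦
    (Commute.all (i : HeckeRing0 L 2) (j : HeckeRing0 L 2)).map (HeckeRing0.dualAction L 2)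
  obtain ⟨v, hvW, hv0, hv⟩ := exists_joint_eigenvector_of_commute t F hc W (fun i _ ↦ hW i) hW0
  -- every `h ∈ ℋ` acts on `v` by a scalar
  have hall : ∀ h : H, ∃ c : ℂ, F h v = c • v := by
    intro h
    have hmem : h ∈ Submodule.span ℤ (t : Set H) := by
      rw [ht]
      exact Submodule.mem_top
    induction hmem using Submodule.span_induction with
    | mem x hx => exact hv x hx
    | zero =>
      refine ⟨0, ?_⟩
      rw [zero_smul]
      change HeckeRing0.dualAction L 2 ((0 : H) : HeckeRing0 L 2) v = 0
      rw [Subalgebra.coe_zero, map_zero, LinearMap.zero_apply]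
    | add x y _ _ hx hy =>
      obtain ⟨c₁, h₁⟩ := hx
      obtain ⟨c₂, h₂⟩ := hy
      refine ⟨c₁ + c₂, ?_⟩
      simp only [F, Subalgebra.coe_add, map_add, LinearMap.add_apply] at h₁ h₂ ⊢
      rw [h₁, h₂, add_smul]
    | smul n x _ hx =>
      obtain ⟨c, h₁⟩ := hx
      refine ⟨(n : ℂ) * c, ?_⟩
      rw [hF] at h₁ ⊢
      rw [Subalgebra.coe_smul, smul_assoc, h₁, ← smul_smul, Int.cast_smul_eq_zsmul]
  choose c hcv using hall
  have huniq : ∀ {c₁ c₂ : ℂ}, c₁ • v = c₂ • v → c₁ = c₂ := fun h ↦ smul_left_injective ℂ hv0 h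
  -- the eigenvalue map is a ring homomorphism killing `P`
  have hc1 : c 1 = 1 := huniq (by
    rw [← hcv 1, one_smul]
    change HeckeRing0.dualAction L 2 ((1 : H) : HeckeRing0 L 2) v = v
    rw [Subalgebra.coe_one, map_one, Module.End.one_apply])
  have hcmul : ∀ x y : H, c (x * y) = c x * c y := fun x y ↦ huniq (by
    rw [← hcv (x * y)]
    simp only [F, Subalgebra.coe_mul, map_mul, Module.End.mul_apply]
    rw [hcv y, map_smul, hcv x, smul_smul, mul_comm])
  have hc0 : c 0 = 0 := huniq (by
    rw [← hcv 0, zero_smul]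
    change HeckeRing0.dualAction L 2 ((0 : H) : HeckeRing0 L 2) v = 0
    rw [Subalgebra.coe_zero, map_zero, LinearMap.zero_apply])
  have hcadd : ∀ x y : H, c (x + y) = c x + c y := fun x y ↦ huniq (by
    rw [← hcv (x + y)]
    simp only [F, Subalgebra.coe_add, map_add, LinearMap.add_apply]
    rw [hcv x, hcv y, add_smul])
  let τ : H →+* ℂ :=
    { toFun := c, map_one' := hc1, map_mul' := hcmul, map_zero' := hc0, map_add' := hcadd }
  have hτ : ∀ h : H, τ h = c h := fun _ ↦ rfl
  have hτP : ∀ h ∈ P, τ h = 0 := fun h hP ↦ huniq (by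
    rw [hτ, ← hcv h, zero_smul]
    exact hPW h hP v hvW)
  refine ⟨Ideal.Quotient.lift P τ hτP, v, hv0, fun h ↦ ?_⟩
  rw [Ideal.Quotient.lift_mk, hτ, ← hF, hcv h]

end EigenElement

/-! ## § 4 Assembly: a mod-`ℓ` eigen-system occurring in `Λ` is the reduction of a newform packet -/

section Assembly

variable (L : ℕ) [NeZero L]

/-- **A mod-`ℓ` Hecke eigen-system occurring in `H₁(X₀(L), ℤ)` is the reduction of the packet of a newform of level
dividing `L`.** Let `ℓ` be prime, `S` a finite set, `a : ℕ → ℤ`, and `w ∈ Λ ∖ ℓΛ` with `(T_p − a_p) w ∈ ℓΛ` for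
all primes `p ≠ ℓ` in `S`. With `ℋ = ℤ[T_p : p ∈ S prime, p ≠ ℓ] ⊆ 𝕋_ℤ` there are: a minimal prime `P` of `ℋ`
with `P ∩ ℤ = 0` and `ℋ/P` module-finite over `ℤ` (an order), ring homomorphisms `ψ : ℋ/P → ℤ/ℓ` and
`σ : ℋ/P ↪ ℂ` (injective), a level `M ∣ L` and a newform `g₀ ∈ S₂(Γ₀(M))`, such that for every prime `p ∈ S`,
`p ≠ ℓ`: `ψ(T_p mod P) = a_p mod ℓ`, and if `p ∤ L` then `a_p(g₀) = σ(T_p mod P)`. (Deligne–Serre 6.11 on `Λ`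
— `exists_deligneSerre_lift_of_eigenvector_mod` — then § 3 and § 2.) This is the «eigenclass mod `ℓ` ⇒ newform
with `a_p(g₀) ≡ a_p (mod λ)`» step, with `λ = σ(ker ψ)`. [cite: DeligneSerre1974, Lemme 6.11 (derived reading: M = H₁(X₀(L),ℤ))] [cite: AtkinLehner1970, Thm. 5 with Thm. 3] -/
theorem exists_isNewform0_of_eigenvector_mod (ℓ : ℕ) (hℓ : ℓ.Prime) (S : Finset ℕ) (a : ℕ → ℤ)
    (w : periodHomologyHecke L) (hw : ∀ u : periodHomologyHecke L, w ≠ (ℓ : ℕ) • u)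
    (heig : ∀ (p : ℕ) (hp : p.Prime), p ≠ ℓ → p ∈ S →
      ∃ u : periodHomologyHecke L, (HeckeRing0.T L 2 p hp - (a p : HeckeRing0 L 2)) • w = (ℓ : ℕ) • u) :
    ∃ (P : Ideal ↥(Algebra.adjoin ℤ
        {t : HeckeRing0 L 2 | ∃ (p : ℕ) (hp : p.Prime), p ≠ ℓ ∧ p ∈ S ∧ t = HeckeRing0.T L 2 p hp}))
      (ψ : ↥(Algebra.adjoin ℤ
        {t : HeckeRing0 L 2 | ∃ (p : ℕ) (hp : p.Prime), p ≠ ℓ ∧ p ∈ S ∧ t = HeckeRing0.T L 2 p hp}) ⧸ P →+*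
          ℤ ⧸ (Ideal.span {(ℓ : ℤ)} : Ideal ℤ))
      (σ : ↥(Algebra.adjoin ℤ
        {t : HeckeRing0 L 2 | ∃ (p : ℕ) (hp : p.Prime), p ≠ ℓ ∧ p ∈ S ∧ t = HeckeRing0.T L 2 p hp}) ⧸ P →+* ℂ)
      (M : ℕ) (_ : NeZero M) (_ : M ∣ L) (g₀ : CuspForm (Gamma0 M) 2),
      P ∈ minimalPrimes _ ∧ P.under ℤ = ⊥ ∧
      Module.Finite ℤ (↥(Algebra.adjoin ℤ
        {t : HeckeRing0 L 2 | ∃ (p : ℕ) (hp : p.Prime), p ≠ ℓ ∧ p ∈ S ∧ t = HeckeRing0.T L 2 p hp}) ⧸ P) ∧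
      Function.Injective σ ∧ IsNewform0 g₀ ∧
      ∀ (p : ℕ) (hp : p.Prime) (hpℓ : p ≠ ℓ) (hpS : p ∈ S),
        ψ (Ideal.Quotient.mk P ⟨HeckeRing0.T L 2 p hp, Algebra.subset_adjoin ⟨p, hp, hpℓ, hpS, rfl⟩⟩) =
            Ideal.Quotient.mk (Ideal.span {(ℓ : ℤ)} : Ideal ℤ) (a p) ∧
          (¬ p ∣ L → cuspCoeff g₀ p =
            σ (Ideal.Quotient.mk P ⟨HeckeRing0.T L 2 p hp, Algebra.subset_adjoin ⟨p, hp, hpℓ, hpS, rfl⟩⟩)) := by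
  classical
  obtain ⟨P, hP, hunder, hinj, hfin, ⟨ψ, hψ⟩, m, hm0, hm⟩ :=
    exists_deligneSerre_lift_of_eigenvector_mod L ℓ hℓ S a w hw heig
  obtain ⟨σ, φ, hφ0, hφ⟩ := exists_ringHom_dual_eigenvector_of_annihilator L _ P m hm0 hm
  -- `σ` is injective: `ℋ/P` is a domain, integral over `ℤ`
  haveI : P.IsPrime := hP.1.1
  haveI := Ideal.Quotient.isDomain P
  haveI : Algebra.IsIntegral ℤ _ := @Algebra.IsIntegral.of_finite ℤ _ _ _ _ hfin
  have hσ : Function.Injective σ := injective_ringHom_of_isIntegral_int σ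
  -- the eigen-functional `φ` has the packet `σ(T_p mod P)` on the primes of `S`
  let c : ℕ → ℂ := fun p ↦
    if h : p.Prime ∧ p ≠ ℓ ∧ p ∈ S then
      σ (Ideal.Quotient.mk P ⟨HeckeRing0.T L 2 p h.1, Algebra.subset_adjoin ⟨p, h.1, h.2.1, h.2.2, rfl⟩⟩)
    else 0
  have hc : ∀ (p : ℕ) (hp : p.Prime) (hpℓ : p ≠ ℓ) (hpS : p ∈ S), c p =
      σ (Ideal.Quotient.mk P ⟨HeckeRing0.T L 2 p hp, Algebra.subset_adjoin ⟨p, hp, hpℓ, hpS, rfl⟩⟩) :=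
    fun p hp hpℓ hpS ↦ dif_pos ⟨hp, hpℓ, hpS⟩
  have heigφ : ∀ p ∈ {p : ℕ | p.Prime ∧ p ≠ ℓ ∧ p ∈ S}, ∀ (hp : p.Prime), ¬ p ∣ L →
      ∀ f : CuspForm (Gamma0 L) 2, φ ((haveI : NeZero p := ⟨hp.ne_zero⟩; heckeT (Gamma0 L) 2 p) f) = c p * φ f := by
    rintro p ⟨hp, hpℓ, hpS⟩ hp' - f
    have h := hφ ⟨HeckeRing0.T L 2 p hp, Algebra.subset_adjoin ⟨p, hp, hpℓ, hpS, rfl⟩⟩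
    have h' := congrArg (fun ψ : Module.Dual ℂ (CuspForm (Gamma0 L) 2) ↦ ψ f) h
    simp only [HeckeRing0.smul_dual_apply, HeckeRing0.toEnd_T, LinearMap.smul_apply, smul_eq_mul] at h'
    rw [hc p hp hpℓ hpS]
    exact h'
  obtain ⟨M, hM, hML, g₀, hg₀, hpk⟩ :=
    exists_isNewform0_of_dual_eigenvector L 2 φ hφ0 {p : ℕ | p.Prime ∧ p ≠ ℓ ∧ p ∈ S} c heigφ
  refine ⟨P, ψ, σ, M, hM, hML, g₀, hP, hunder, hfin, hσ, hg₀, fun p hp hpℓ hpS ↦ ⟨hψ p hp hpℓ hpS, fun hpL ↦ ?_⟩⟩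
  rw [hpk p ⟨hp, hpℓ, hpS⟩ hp hpL, hc p hp hpℓ hpS]

end Assembly

/-! ## § 5 Corollaries in the shape of the TQMP items (`ℓ = 3`): generalised eigenvectors at level `L`,
and the norm image at level `N` versus newforms of level dividing `N/3` -/

section Three

variable (L : ℕ) [NeZero L]

/-- **L31-shape.** A joint GENERALISED mod-`3` Hecke eigenvector `y ∈ Λ_L ∖ 3Λ_L` (`(T_p − a_p)^{k_p} y ∈ 3Λ_L`
for the primes `p ≠ 3` of `S`) already yields the newform-packet conclusion of `exists_isNewform0_of_eigenvector_mod`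
(`ℓ = 3`): reduce to an honest eigenvector by `exists_eigenvector_mod_three_of_genEigenvector` (Hoffman–Kunze § 6.5).
So «no weight-2 newform of level dividing `L` has `a_p(g₀) ≡ a_p (mod λ)` for all `p ∈ S`» implies the L31-type
statement «every such `y` lies in `3Λ_L`». [cite: DeligneSerre1974, Lemme 6.11 (derived reading: M = H₁(X₀(L),ℤ), ℓ = 3)] [cite: AtkinLehner1970, Thm. 5 with Thm. 3] -/
theorem exists_isNewform0_of_genEigenvector_mod_three (S : Finset ℕ) (a : ℕ → ℤ) (y : periodHomologyHecke L)
    (hy : ∀ (p : ℕ) (hp : p.Prime), p ≠ 3 → p ∈ S →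
      ∃ (k : ℕ) (u : periodHomologyHecke L),
        (HeckeRing0.T L 2 p hp - (a p : HeckeRing0 L 2)) ^ k • y = (3 : ℕ) • u)
    (hne : ∀ u : periodHomologyHecke L, y ≠ (3 : ℕ) • u) :
    ∃ (P : Ideal ↥(Algebra.adjoin ℤ
        {t : HeckeRing0 L 2 | ∃ (p : ℕ) (hp : p.Prime), p ≠ 3 ∧ p ∈ S ∧ t = HeckeRing0.T L 2 p hp}))
      (ψ : ↥(Algebra.adjoin ℤ
        {t : HeckeRing0 L 2 | ∃ (p : ℕ) (hp : p.Prime), p ≠ 3 ∧ p ∈ S ∧ t = HeckeRing0.T L 2 p hp}) ⧸ P →+*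
          ℤ ⧸ (Ideal.span {((3 : ℕ) : ℤ)} : Ideal ℤ))
      (σ : ↥(Algebra.adjoin ℤ
        {t : HeckeRing0 L 2 | ∃ (p : ℕ) (hp : p.Prime), p ≠ 3 ∧ p ∈ S ∧ t = HeckeRing0.T L 2 p hp}) ⧸ P →+* ℂ)
      (M : ℕ) (_ : NeZero M) (_ : M ∣ L) (g₀ : CuspForm (Gamma0 M) 2),
      P ∈ minimalPrimes _ ∧ P.under ℤ = ⊥ ∧
      Module.Finite ℤ (↥(Algebra.adjoin ℤ
        {t : HeckeRing0 L 2 | ∃ (p : ℕ) (hp : p.Prime), p ≠ 3 ∧ p ∈ S ∧ t = HeckeRing0.T L 2 p hp}) ⧸ P) ∧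
      Function.Injective σ ∧ IsNewform0 g₀ ∧
      ∀ (p : ℕ) (hp : p.Prime) (hp3 : p ≠ 3) (hpS : p ∈ S),
        ψ (Ideal.Quotient.mk P ⟨HeckeRing0.T L 2 p hp, Algebra.subset_adjoin ⟨p, hp, hp3, hpS, rfl⟩⟩) =
            Ideal.Quotient.mk (Ideal.span {((3 : ℕ) : ℤ)} : Ideal ℤ) (a p) ∧
          (¬ p ∣ L → cuspCoeff g₀ p =
            σ (Ideal.Quotient.mk P ⟨HeckeRing0.T L 2 p hp, Algebra.subset_adjoin ⟨p, hp, hp3, hpS, rfl⟩⟩)) := by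
  obtain ⟨w, hw, heig⟩ := exists_eigenvector_mod_three_of_genEigenvector L S a y hy hne
  exact exists_isNewform0_of_eigenvector_mod L 3 Nat.prime_three S a w hw heig

variable [NeZero (L / 3)] (h9 : 3 ^ 2 ∣ L)

/-- **H1-shape** (`9 ∣ L`): if `z ∈ Λ_L` has `Nm((T_p − a_p)^{k_p} z) ∈ 3Λ_L` for the primes `p ≠ 3` of `S` but
`Nm z ∉ 3Λ_L`, then there is a weight-`2` NEWFORM `g₀` OF LEVEL DIVIDING `L/3` whose Hecke packet reduces to
`(a_p mod 3)_{p ∈ S}`: with `ℋ = ℤ[T_p : p ∈ S, p ≠ 3] ⊆ 𝕋_ℤ(L/3)`, an order `ℋ/P`, `ψ : ℋ/P → ℤ/3`, `σ : ℋ/P ↪ ℂ`,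
`a_p(g₀) = σ(T_p mod P)` (`p ∤ L/3`) and `ψ(T_p mod P) = a_p mod 3`
(`exists_eigenvector_mod_three_level_div_three_of_normInt` + `exists_isNewform0_of_eigenvector_mod` at level `L/3`).
For the TQMP item H1 (`a_p = a_p(W)`): a failure of H1 produces a newform of level dividing `N/3` congruent to `W`
mod `3` on `S` — the object a Serre-weight argument at level `N/3` excludes. [cite: DeligneSerre1974, Lemme 6.11 (derived reading: M = H₁(X₀(L/3),ℤ), ℓ = 3)] [cite: LangeRodriguez2022, Prop. 3.5.1 and §3.2.1 (derived reading, see `exists_normInt_eq_three_smul_of_level_div_three`)] -/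
theorem exists_isNewform0_level_div_three_of_normInt (S : Finset ℕ) (a : ℕ → ℤ) (z : periodHomologyHecke L)
    (hz : ∀ (p : ℕ) (hp : p.Prime), p ≠ 3 → p ∈ S →
      ∃ (k : ℕ) (u : periodHomologyHecke L),
        normInt L h9 ((HeckeRing0.T L 2 p hp - (a p : HeckeRing0 L 2)) ^ k • z) = (3 : ℕ) • u)
    (hne : ∀ u : periodHomologyHecke L, normInt L h9 z ≠ (3 : ℕ) • u) :
    ∃ (P : Ideal ↥(Algebra.adjoin ℤ
        {t : HeckeRing0 (L / 3) 2 | ∃ (p : ℕ) (hp : p.Prime), p ≠ 3 ∧ p ∈ S ∧ t = HeckeRing0.T (L / 3) 2 p hp}))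
      (ψ : ↥(Algebra.adjoin ℤ
        {t : HeckeRing0 (L / 3) 2 | ∃ (p : ℕ) (hp : p.Prime), p ≠ 3 ∧ p ∈ S ∧ t = HeckeRing0.T (L / 3) 2 p hp}) ⧸ P →+*
          ℤ ⧸ (Ideal.span {((3 : ℕ) : ℤ)} : Ideal ℤ))
      (σ : ↥(Algebra.adjoin ℤ
        {t : HeckeRing0 (L / 3) 2 | ∃ (p : ℕ) (hp : p.Prime), p ≠ 3 ∧ p ∈ S ∧ t = HeckeRing0.T (L / 3) 2 p hp}) ⧸ P →+* ℂ)
      (M : ℕ) (_ : NeZero M) (_ : M ∣ (L / 3)) (g₀ : CuspForm (Gamma0 M) 2),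
      P ∈ minimalPrimes _ ∧ P.under ℤ = ⊥ ∧
      Module.Finite ℤ (↥(Algebra.adjoin ℤ
        {t : HeckeRing0 (L / 3) 2 | ∃ (p : ℕ) (hp : p.Prime), p ≠ 3 ∧ p ∈ S ∧ t = HeckeRing0.T (L / 3) 2 p hp}) ⧸ P) ∧
      Function.Injective σ ∧ IsNewform0 g₀ ∧
      ∀ (p : ℕ) (hp : p.Prime) (hp3 : p ≠ 3) (hpS : p ∈ S),
        ψ (Ideal.Quotient.mk P ⟨HeckeRing0.T (L / 3) 2 p hp, Algebra.subset_adjoin ⟨p, hp, hp3, hpS, rfl⟩⟩) =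
            Ideal.Quotient.mk (Ideal.span {((3 : ℕ) : ℤ)} : Ideal ℤ) (a p) ∧
          (¬ p ∣ (L / 3) → cuspCoeff g₀ p =
            σ (Ideal.Quotient.mk P ⟨HeckeRing0.T (L / 3) 2 p hp, Algebra.subset_adjoin ⟨p, hp, hp3, hpS, rfl⟩⟩)) := by
  obtain ⟨w, hw, heig⟩ := exists_eigenvector_mod_three_level_div_three_of_normInt L h9 S a z hz hne
  exact exists_isNewform0_of_eigenvector_mod (L / 3) 3 Nat.prime_three S a w hw heig

end Three

/-! ## § 6 A prime of a ring of integers compatible with the mod-`ℓ` character (lying over) -/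

section CompatiblePrime

/-- **Lying over, in the form the Galois step consumes.** Let `R` be a commutative ring, module-finite over `ℤ`
(e.g. the order `ℋ/P` of § 4), `σ : R ↪ ℂ` an injective ring homomorphism with values in a subfield `K ⊆ ℂ`
(e.g. the coefficient field of the newform `g₀` of § 4, which contains the `a_p(g₀) = σ(T_p mod P)`), and
`ψ : R → ℤ/ℓ` a ring homomorphism, `ℓ` prime. Then `σ` co-restricts to `j : R → 𝒪_K = \bar ℤ ∩ K`
(`integralClosure ℤ K`; `R` is integral over `ℤ`), and there is a MAXIMAL ideal `𝔐 ⊂ 𝒪_K` with `ℓ ∈ 𝔐` such that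
`j(r) ≡ z (mod 𝔐)` whenever `ψ(r) = z mod ℓ` — `𝔐` lies over `ker ψ` along the integral extension `j`
(Atiyah–Macdonald Thm. 5.10 with Cor. 5.8; Mathlib `Ideal.exists_ideal_over_maximal_of_isIntegral`). With
`k = \overline{𝒪_K/𝔐}` and `ι : 𝒪_K → k` the reduction, `ι(a_p(g₀)) = a_p mod ℓ` for the primes of § 4/§ 5.
[cite: AtiyahMacdonald1969, Thm. 5.10 with Cor. 5.8] -/
theorem exists_maximal_ideal_over_ker {R : Type*} [CommRing R] [Module.Finite ℤ R]
    (K : IntermediateField ℚ ℂ) (σ : R →+* ℂ) (hσ : Function.Injective σ) (hσK : ∀ r, σ r ∈ K)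
    {ℓ : ℕ} (hℓ : ℓ.Prime) (ψ : R →+* ℤ ⧸ (Ideal.span {(ℓ : ℤ)} : Ideal ℤ)) :
    ∃ (j : R →+* integralClosure ℤ K) (𝔐 : Ideal (integralClosure ℤ K)), 𝔐.IsMaximal ∧
      (∀ r, (((j r : K) : ℂ)) = σ r) ∧ (ℓ : integralClosure ℤ K) ∈ 𝔐 ∧
      ∀ (r : R) (z : ℤ), ψ r = Ideal.Quotient.mk _ z → j r - (z : integralClosure ℤ K) ∈ 𝔐 := by
  classical
  -- co-restriction of `σ` to `K`, then to `𝒪_K`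
  let σK : R →+* K := σ.codRestrict K hσK
  have hσK_apply : ∀ r, ((σK r : K) : ℂ) = σ r := fun _ ↦ rfl
  have hint : ∀ r, σK r ∈ integralClosure ℤ K := fun r ↦ by
    rw [mem_integralClosure_iff]
    have h2 : IsIntegral ℤ (σ r) := (Algebra.IsIntegral.isIntegral (R := ℤ) r).map σ.toIntAlgHom
    rw [← hσK_apply] at h2
    exact (isIntegral_algHom_iff (algebraMap K ℂ).toIntAlgHom (algebraMap K ℂ).injective).mp h2
  let j : R →+* integralClosure ℤ K := σK.codRestrict (integralClosure ℤ K) hint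
  have hj : ∀ r, (((j r : K) : ℂ)) = σ r := fun _ ↦ rfl
  have hjinj : Function.Injective j := fun a b h ↦ hσ (by rw [← hj, ← hj, h])
  -- `ker ψ` is maximal (`ψ` is onto the field `ℤ/ℓ`)
  haveI : (Ideal.span {(ℓ : ℤ)} : Ideal ℤ).IsMaximal :=
    PrincipalIdealRing.isMaximal_of_irreducible (Nat.prime_iff_prime_int.mp hℓ).irreducible
  have hmkz : ∀ z : ℤ, (Ideal.Quotient.mk (Ideal.span {(ℓ : ℤ)} : Ideal ℤ)) z =
      (z : ℤ ⧸ (Ideal.span {(ℓ : ℤ)} : Ideal ℤ)) := fun z ↦ by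
    have h := map_intCast (Ideal.Quotient.mk (Ideal.span {(ℓ : ℤ)} : Ideal ℤ)) z
    rwa [Int.cast_id] at h
  have hsurj : Function.Surjective ψ := by
    intro x
    obtain ⟨z, rfl⟩ := Ideal.Quotient.mk_surjective x
    exact ⟨z, by rw [map_intCast, hmkz]⟩
  letI := Ideal.Quotient.field (Ideal.span {(ℓ : ℤ)} : Ideal ℤ)
  haveI hmax : (RingHom.ker ψ).IsMaximal := RingHom.ker_isMaximal_of_surjective ψ hsurj
  -- lying over along the integral extension `j : R → 𝒪_K`
  letI : Algebra R (integralClosure ℤ K) := j.toAlgebra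
  haveI : Algebra.IsIntegral R (integralClosure ℤ K) :=
    ⟨fun x ↦ (Algebra.IsIntegral.isIntegral (R := ℤ) x).tower_top⟩
  have hker : RingHom.ker (algebraMap R (integralClosure ℤ K)) ≤ RingHom.ker ψ := by
    rw [show algebraMap R (integralClosure ℤ K) = j from rfl, (RingHom.injective_iff_ker_eq_bot j).mp hjinj]
    exact bot_le
  obtain ⟨𝔐, h𝔐max, hcomap⟩ := Ideal.exists_ideal_over_maximal_of_isIntegral (RingHom.ker ψ) hker
  have hmem : ∀ r : R, r ∈ RingHom.ker ψ → j r ∈ 𝔐 := fun r hr ↦ by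
    rw [← hcomap, Ideal.mem_comap] at hr
    exact hr
  refine ⟨j, 𝔐, h𝔐max, hj, ?_, fun r z hrz ↦ ?_⟩
  · have h := hmem (ℓ : R) (by
      rw [RingHom.mem_ker, map_natCast, ← map_natCast (Ideal.Quotient.mk (Ideal.span {(ℓ : ℤ)} : Ideal ℤ)) ℓ,
        Ideal.Quotient.eq_zero_iff_mem]
      exact Ideal.mem_span_singleton_self _)
    rwa [map_natCast] at h
  · have h := hmem (r - (z : R)) (by
      rw [RingHom.mem_ker, map_sub, map_intCast, hrz, hmkz, sub_self])
    rwa [map_sub, map_intCast] at h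

end CompatiblePrime

end Literature.NumberTheory.ModularSymbols
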